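import Literature.Analysis.FluidPDE.KNSSRegularityGalilean
import HarnessLib

/-!
# The moving-frame fundamental theorem of calculus with a rough scalar multiplier in time

Analysis/FluidPDE **proofs file** (theorems only: no definitions, no named facts, no `sorry`),
infrastructure for the swirl half (ii) of the named fact
`Literature.Analysis.FluidPDE.leiRenZhang2019_sliding` (Lei–Ren–Zhang, arXiv:1902.11229, Lemma 5.1:
in its proof "one can convert the above equation into the standard heat equation by a change
of variable" — a Galilean change of frame along the local velocity of the ancient solution).

For the tree's regular representative `U + β(t) e_z` of a bounded ancient axisymmetric solution
(KNSS 2009, §4, `KNSS2009_regularity_axisymmetric_swirl`) the swirl `Γ = swirl (U t)` satisfies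
the swirl equation integrated in time,
`Γ(σ, w) = Γ(s, w) + ∫ₛ^σ (ΔΓ − DΓ[U] − (2/r)∂ᵣΓ − β(ρ) DΓ[e_z])(ρ, w) dρ` off the axis, whose
integrand is `φ₁(ρ, w) + β(ρ) • φ₂(ρ, w)` with `φ₁`, `φ₂` jointly continuous and `β` merely
bounded measurable (the parasitic drift). The tree's moving-frame FTC
`sub_eq_integral_of_path` (`KNSSRegularityGalilean`) needs a jointly continuous integrand on all
of space; this file proves the variant needed to pass to a Galilean frame
`x = z(σ) + y`, `z' = U(σ, x₀) + β(σ) e_z ∈ L^∞`, in which the drift of the swirl equation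
becomes small far from the axis:

* `sub_eq_integral_of_path_add_smul` — **chain rule along a Lipschitz path, integrated form,
  for integrands `φ₁ + β(ρ) • φ₂` and locally on a ball.** If
  `Φ σ w = Φ s w + ∫ₛ^σ (φ₁ ρ w + β ρ • φ₂ ρ w) dρ` for `σ ∈ [s, t]` and `w` in an open ball
  `B(c, R₀)`, with `φ₁`, `φ₂` jointly continuous and `(σ, w) ↦ D(Φ σ)(w)` jointly continuous on
  `[s, t] × B(c, R₀)`, every slice `Φ σ` differentiable on the ball, `β` bounded measurable, and
  `z σ = z s + ∫ₛ^σ z'` a path with bounded measurable velocity staying in a closed ball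
  `B̄(c, R₁)`, `R₁ < R₀`, then
  `Φ t (z t) − Φ s (z s) = ∫ₛᵗ (φ₁ σ (z σ) + β σ • φ₂ σ (z σ) + D(Φ σ)(z σ)[z' σ]) dσ`.
  Proof: the composite is Lipschitz; at a.e. `σ` — where `z` is differentiable with derivative
  `z' σ` and `σ ↦ ∫ β` is differentiable with derivative `β σ` (Lebesgue's differentiation theorem,
  `LocallyIntegrable.ae_hasDerivAt_integral`, applied to both) — it is differentiable with the
  displayed derivative, the rough term being `∫_σ^{σ+h} β ρ • φ₂ ρ (z(σ+h)) dρ =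
  (∫_σ^{σ+h} β) • φ₂ σ (z σ) + o(h)` by joint continuity of `φ₂` and `|β| ≤ C`; conclude by the
  Lipschitz FTC `sub_eq_integral_of_lipschitzOnWith_of_ae_hasDerivAt`.

## Mathlib / tree search

Tree: `sub_eq_integral_of_path`, `sub_eq_integral_of_lipschitzOnWith_of_ae_hasDerivAt`,
`locallyIntegrable_of_norm_le`, `intervalIntegrable_of_norm_le` (`KNSSRegularityGalilean`).
Mathlib: `LocallyIntegrable.ae_hasDerivAt_integral`, `Convex.norm_image_sub_le_of_norm_fderiv_le`,
`IsCompact.exists_bound_of_continuousOn`, `hasDerivAt_iff_isLittleO`.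

## References

* Z. Lei, X. Ren, Q. S. Zhang, *On ancient periodic solutions to axially-symmetric Navier–Stokes
  equations*, arXiv:1902.11229, proof of Lemma 5.1 (arXiv p. 13: "convert the above equation
  into the standard heat equation by a change of variable"). [LeiRenZhang2019]
* G. Koch, N. Nadirashvili, G. Seregin, V. Šverák, Acta Math. 203 (2009) = arXiv:0709.3599, §1
  p. 3 (the parasitic solutions `b(t)` and the Galilean frame `y = x + B(t)`, `B' = b ∈ L^∞`).
  [KochNadirashviliSereginSverak2009]
-/

noncomputable section

open MeasureTheory Set Function Filter TopologicalSpace Metric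
open _root_.Topology
open scoped NNReal Interval

namespace Literature.Analysis.FluidPDE

section PathFTC

variable {E : Type*} [NormedAddCommGroup E] [NormedSpace ℝ E] [FiniteDimensional ℝ E]
variable {F : Type*} [NormedAddCommGroup F] [NormedSpace ℝ F] [CompleteSpace F]

/-- Points of `Ι σ x` lie in `[s, t]` and within `|x − σ|` of `σ`, for `σ, x ∈ [s, t]`. [folklore] -/
private theorem mem_Icc_and_abs_le_of_mem_uIoc_aux {s t σ x ρ : ℝ} (hσ : σ ∈ Icc s t)
    (hx : x ∈ Icc s t) (hρ : ρ ∈ Ι σ x) : ρ ∈ Icc s t ∧ |ρ - σ| ≤ |x - σ| := by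
  rcases le_total σ x with h | h
  · rw [uIoc_of_le h] at hρ
    refine ⟨⟨hσ.1.trans hρ.1.le, hρ.2.trans hx.2⟩, ?_⟩
    rw [abs_of_nonneg (by linarith [hρ.1]), abs_of_nonneg (by linarith)]
    linarith [hρ.2]
  · rw [uIoc_of_ge h] at hρ
    refine ⟨⟨hx.1.trans hρ.1.le, hρ.2.trans hσ.2⟩, ?_⟩
    rw [abs_of_nonpos (by linarith [hρ.2]), abs_of_nonpos (by linarith)]
    linarith [hρ.1]

/-- **Chain rule along a Lipschitz path, integrated form, for time-integrands with a rough
scalar multiplier, locally on a ball** (the calculus behind the Galilean frame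
`x = z(σ) + y`, `z' ∈ L^∞`, for the swirl equation with parasitic drift `β(t) e_z`; cf. the
tree's `sub_eq_integral_of_path` for jointly continuous integrands). Let
`Φ σ w = Φ s w + ∫ₛ^σ (φ₁ ρ w + β ρ • φ₂ ρ w) dρ` on `[s, t] × B(c, R₀)` with `φ₁`, `φ₂` jointly
continuous there, every slice `Φ σ` differentiable on `B(c, R₀)` with `(σ, w) ↦ D(Φ σ)(w)`
jointly continuous, `β` measurable with `|β| ≤ C_β`, and let `z σ = z s + ∫ₛ^σ z'` be a path with
bounded a.e. strongly measurable velocity `z'` staying in `B̄(c, R₁)`, `R₁ < R₀`, on `[s, t]`.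
Then `Φ t (z t) − Φ s (z s) = ∫ₛᵗ (φ₁ σ (z σ) + β σ • φ₂ σ (z σ) + D(Φ σ)(z σ)[z' σ]) dσ`. [cite: KochNadirashviliSereginSverak2009, §1 p. 3 (Galilean frame y = x + B(t), B' = b ∈ L^∞); LeiRenZhang2019, proof of Lemma 5.1 (arXiv p. 13)] -/
theorem sub_eq_integral_of_path_add_smul {Φ φ₁ φ₂ : ℝ → E → F} {β : ℝ → ℝ} {z z' : ℝ → E}
    {s t : ℝ} {c : E} {R₀ R₁ : ℝ} (hst : s ≤ t) (hR : R₁ < R₀)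
    (hΦ : ∀ σ ∈ Icc s t, ∀ w ∈ ball c R₀,
      Φ σ w = Φ s w + ∫ ρ in s..σ, (φ₁ ρ w + β ρ • φ₂ ρ w))
    (hφ₁ : ContinuousOn (uncurry φ₁) (Icc s t ×ˢ ball c R₀))
    (hφ₂ : ContinuousOn (uncurry φ₂) (Icc s t ×ˢ ball c R₀))
    (hβm : Measurable β) {Cβ : ℝ} (hβC : ∀ ρ, |β ρ| ≤ Cβ)
    (hΦd : ∀ σ ∈ Icc s t, ∀ w ∈ ball c R₀, DifferentiableAt ℝ (Φ σ) w)
    (hDΦ : ContinuousOn (fun p : ℝ × E => fderiv ℝ (Φ p.1) p.2) (Icc s t ×ˢ ball c R₀))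
    (hz'm : AEStronglyMeasurable z' volume) {N : ℝ} (hz'N : ∀ σ, ‖z' σ‖ ≤ N)
    (hz : ∀ σ ∈ Icc s t, z σ = z s + ∫ ρ in s..σ, z' ρ)
    (hzin : ∀ σ ∈ Icc s t, z σ ∈ closedBall c R₁) :
    Φ t (z t) - Φ s (z s) =
      ∫ σ in s..t, (φ₁ σ (z σ) + β σ • φ₂ σ (z σ) + fderiv ℝ (Φ σ) (z σ) (z' σ)) := by
  have hN0 : 0 ≤ N := (norm_nonneg _).trans (hz'N s)
  have hCβ0 : 0 ≤ Cβ := (abs_nonneg _).trans (hβC s)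
  have hsub : closedBall c R₁ ⊆ ball c R₀ := closedBall_subset_ball hR
  have hzB : ∀ σ ∈ Icc s t, z σ ∈ ball c R₀ := fun σ hσ => hsub (hzin σ hσ)
  have hz'i : ∀ x y : ℝ, IntervalIntegrable z' volume x y := intervalIntegrable_of_norm_le hz'm hz'N
  have hβn : ∀ ρ, ‖β ρ‖ ≤ Cβ := fun ρ => by rw [Real.norm_eq_abs]; exact hβC ρ
  have hβi : ∀ x y : ℝ, IntervalIntegrable β volume x y :=
    intervalIntegrable_of_norm_le hβm.aestronglyMeasurable hβn
  -- the path is Lipschitz and continuous on `[s, t]`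
  have hzsub : ∀ σ₁ ∈ Icc s t, ∀ σ₂ ∈ Icc s t, z σ₂ - z σ₁ = ∫ ρ in σ₁..σ₂, z' ρ := by
    intro σ₁ h₁ σ₂ h₂
    rw [hz σ₂ h₂, hz σ₁ h₁, add_sub_add_left_eq_sub,
      intervalIntegral.integral_interval_sub_left (hz'i s σ₂) (hz'i s σ₁)]
  have hzlip : ∀ σ₁ ∈ Icc s t, ∀ σ₂ ∈ Icc s t, ‖z σ₂ - z σ₁‖ ≤ N * |σ₂ - σ₁| := by
    intro σ₁ h₁ σ₂ h₂
    rw [hzsub σ₁ h₁ σ₂ h₂]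
    exact intervalIntegral.norm_integral_le_of_norm_le_const fun ρ _ => hz'N ρ
  have hzcont : ContinuousOn z (Icc s t) := by
    have h1 : ContinuousOn (fun σ => z s + ∫ ρ in s..σ, z' ρ) (Icc s t) :=
      (continuousOn_const.add
        ((intervalIntegral.continuous_primitive (fun x y => hz'i x y) s).continuousOn))
    exact h1.congr fun σ hσ => hz σ hσ
  -- bounds for `φ₁`, `φ₂`, `DΦ` over the compact `[s, t] × B̄(c, R₁)`
  have hcpt : IsCompact (Icc s t ×ˢ closedBall c R₁) := isCompact_Icc.prod (isCompact_closedBall c R₁)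
  have hKsub : Icc s t ×ˢ closedBall c R₁ ⊆ Icc s t ×ˢ ball c R₀ := prod_mono Subset.rfl hsub
  obtain ⟨M₁, hM₁⟩ := hcpt.exists_bound_of_continuousOn (hφ₁.mono hKsub)
  obtain ⟨M₂, hM₂⟩ := hcpt.exists_bound_of_continuousOn (hφ₂.mono hKsub)
  obtain ⟨MD, hMD⟩ := hcpt.exists_bound_of_continuousOn (hDΦ.mono hKsub)
  have hM₁' : ∀ σ ∈ Icc s t, ∀ w ∈ closedBall c R₁, ‖φ₁ σ w‖ ≤ M₁ := fun σ hσ w hw =>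
    hM₁ (σ, w) (mk_mem_prod hσ hw)
  have hM₂' : ∀ σ ∈ Icc s t, ∀ w ∈ closedBall c R₁, ‖φ₂ σ w‖ ≤ M₂ := fun σ hσ w hw =>
    hM₂ (σ, w) (mk_mem_prod hσ hw)
  have hMD' : ∀ σ ∈ Icc s t, ∀ w ∈ closedBall c R₁, ‖fderiv ℝ (Φ σ) w‖ ≤ MD := fun σ hσ w hw =>
    hMD (σ, w) (mk_mem_prod hσ hw)
  have hs0 : s ∈ Icc s t := left_mem_Icc.2 hst
  have hM₁0 : 0 ≤ M₁ := (norm_nonneg _).trans (hM₁' s hs0 (z s) (hzin s hs0))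
  have hM₂0 : 0 ≤ M₂ := (norm_nonneg _).trans (hM₂' s hs0 (z s) (hzin s hs0))
  have hMD0 : 0 ≤ MD := (norm_nonneg _).trans (hMD' s hs0 (z s) (hzin s hs0))
  -- the full integrand `φ ρ w = φ₁ ρ w + β ρ • φ₂ ρ w`, bounded by `Mφ` at points of the path
  set φ : ℝ → E → F := fun ρ w => φ₁ ρ w + β ρ • φ₂ ρ w with hφdef
  set Mφ : ℝ := M₁ + Cβ * M₂ with hMφ
  have hMφ0 : 0 ≤ Mφ := by positivity
  have hMφ' : ∀ ρ ∈ Icc s t, ∀ w ∈ closedBall c R₁, ‖φ ρ w‖ ≤ Mφ := by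
    intro ρ hρ w hw
    calc ‖φ ρ w‖ ≤ ‖φ₁ ρ w‖ + ‖β ρ • φ₂ ρ w‖ := norm_add_le _ _
      _ ≤ M₁ + Cβ * M₂ := by
          rw [norm_smul]
          exact add_le_add (hM₁' ρ hρ w hw)
            (mul_le_mul (hβn ρ) (hM₂' ρ hρ w hw) (norm_nonneg _) hCβ0)
  -- interval integrability of `ρ ↦ φ ρ w` on subintervals of `[s, t]`, for `w` in the closed ball
  have hφ₂c : ∀ w ∈ ball c R₀, ContinuousOn (fun ρ => φ₂ ρ w) (Icc s t) := fun w hw =>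
    hφ₂.comp (continuousOn_id.prodMk continuousOn_const) fun ρ hρ => mk_mem_prod hρ hw
  have hφ₁c : ∀ w ∈ ball c R₀, ContinuousOn (fun ρ => φ₁ ρ w) (Icc s t) := fun w hw =>
    hφ₁.comp (continuousOn_id.prodMk continuousOn_const) fun ρ hρ => mk_mem_prod hρ hw
  have hφi : ∀ w ∈ ball c R₀, ∀ σ₁ ∈ Icc s t, ∀ σ₂ ∈ Icc s t,
      IntervalIntegrable (fun ρ => φ ρ w) volume σ₁ σ₂ := by
    intro w hw σ₁ h₁ σ₂ h₂
    have h1 : IntervalIntegrable (fun ρ => φ₁ ρ w) volume σ₁ σ₂ :=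
      ((hφ₁c w hw).mono (uIcc_subset_Icc h₁ h₂)).intervalIntegrable
    have h2 : IntervalIntegrable (fun ρ => β ρ • φ₂ ρ w) volume σ₁ σ₂ :=
      (hβi σ₁ σ₂).smul_continuousOn ((hφ₂c w hw).mono (uIcc_subset_Icc h₁ h₂))
    exact h1.add h2
  -- differences in time are integrals of `φ`
  have hΦsub : ∀ σ₁ ∈ Icc s t, ∀ σ₂ ∈ Icc s t, ∀ w ∈ ball c R₀,
      Φ σ₂ w - Φ σ₁ w = ∫ ρ in σ₁..σ₂, φ ρ w := by
    intro σ₁ h₁ σ₂ h₂ w hw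
    rw [hΦ σ₂ h₂ w hw, hΦ σ₁ h₁ w hw, add_sub_add_left_eq_sub,
      intervalIntegral.integral_interval_sub_left (hφi w hw s hs0 σ₂ h₂) (hφi w hw s hs0 σ₁ h₁)]
  -- the composite and its Lipschitz bound
  set Ψ : ℝ → F := fun σ => Φ σ (z σ) with hΨ
  have hΨlip : LipschitzOnWith ⟨Mφ + MD * N, by positivity⟩ Ψ (Icc s t) := by
    refine LipschitzOnWith.of_dist_le_mul fun σ₁ h₁ σ₂ h₂ => ?_
    rw [dist_eq_norm, Real.dist_eq]
    have e : Ψ σ₁ - Ψ σ₂ = (Φ σ₁ (z σ₁) - Φ σ₂ (z σ₁)) + (Φ σ₂ (z σ₁) - Φ σ₂ (z σ₂)) := by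
      simp only [hΨ]; abel
    rw [e]
    have h1 : ‖Φ σ₁ (z σ₁) - Φ σ₂ (z σ₁)‖ ≤ Mφ * |σ₁ - σ₂| := by
      rw [hΦsub σ₂ h₂ σ₁ h₁ (z σ₁) (hzB σ₁ h₁)]
      refine intervalIntegral.norm_integral_le_of_norm_le_const fun ρ hρ => ?_
      exact hMφ' ρ (mem_Icc_and_abs_le_of_mem_uIoc_aux h₂ h₁ hρ).1 (z σ₁) (hzin σ₁ h₁)
    have h2 : ‖Φ σ₂ (z σ₁) - Φ σ₂ (z σ₂)‖ ≤ MD * N * |σ₁ - σ₂| := by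
      have hmv : ‖Φ σ₂ (z σ₁) - Φ σ₂ (z σ₂)‖ ≤ MD * ‖z σ₁ - z σ₂‖ :=
        (convex_closedBall c R₁).norm_image_sub_le_of_norm_fderiv_le
          (fun w hw => hΦd σ₂ h₂ w (hsub hw)) (fun w hw => hMD' σ₂ h₂ w hw) (hzin σ₂ h₂)
          (hzin σ₁ h₁)
      calc ‖Φ σ₂ (z σ₁) - Φ σ₂ (z σ₂)‖ ≤ MD * ‖z σ₁ - z σ₂‖ := hmv
        _ ≤ MD * (N * |σ₁ - σ₂|) := mul_le_mul_of_nonneg_left (hzlip σ₂ h₂ σ₁ h₁) hMD0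
        _ = MD * N * |σ₁ - σ₂| := by ring
    calc ‖(Φ σ₁ (z σ₁) - Φ σ₂ (z σ₁)) + (Φ σ₂ (z σ₁) - Φ σ₂ (z σ₂))‖
        ≤ Mφ * |σ₁ - σ₂| + MD * N * |σ₁ - σ₂| := (norm_add_le _ _).trans (add_le_add h1 h2)
      _ = ((⟨Mφ + MD * N, by positivity⟩ : ℝ≥0) : ℝ) * |σ₁ - σ₂| := by push_cast; ring
  -- a.e. time: the path is differentiable and `σ` is a Lebesgue point of `β`
  have hzderiv : ∀ᵐ σ, σ ∈ Ioo s t → HasDerivAt z (z' σ) σ := by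
    filter_upwards [_root_.LocallyIntegrable.ae_hasDerivAt_integral
      (locallyIntegrable_of_norm_le hz'm hz'N)] with σ hσ hσI
    have hev : z =ᶠ[𝓝 σ] fun x => z s + ∫ ρ in s..x, z' ρ :=
      eventuallyEq_of_mem (Icc_mem_nhds hσI.1 hσI.2) fun x hx => hz x hx
    exact ((hσ s).const_add (z s)).congr_of_eventuallyEq hev
  have hβderiv : ∀ᵐ σ : ℝ, HasDerivAt (fun x => ∫ ρ in σ..x, β ρ) (β σ) σ := by
    filter_upwards [_root_.LocallyIntegrable.ae_hasDerivAt_integral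
      (locallyIntegrable_of_norm_le hβm.aestronglyMeasurable hβn)] with σ hσ
    exact hσ σ
  have hderiv : ∀ᵐ σ, σ ∈ Ioo s t →
      HasDerivAt Ψ (φ σ (z σ) + fderiv ℝ (Φ σ) (z σ) (z' σ)) σ := by
    filter_upwards [hzderiv, hβderiv] with σ hσ hβσ hσI
    have hzσ := hσ hσI
    have hσc : σ ∈ Icc s t := Ioo_subset_Icc_self hσI
    -- near `σ`, `Ψ x = Φ σ (z x) + ∫_σ^x φ ρ (z x) dρ`
    have hev : Ψ =ᶠ[𝓝 σ] fun x => Φ σ (z x) + ∫ ρ in σ..x, φ ρ (z x) := by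
      refine eventuallyEq_of_mem (Icc_mem_nhds hσI.1 hσI.2) fun x hx => ?_
      simp only [hΨ]
      rw [← hΦsub σ hσc x hx (z x) (hzB x hx)]
      abel
    -- derivative of the first term: chain rule
    have h1 : HasDerivAt (fun x => Φ σ (z x)) (fderiv ℝ (Φ σ) (z σ) (z' σ)) σ :=
      (hΦd σ hσc (z σ) (hzB σ hσc)).hasFDerivAt.comp_hasDerivAt σ hzσ
    -- derivative of the second term
    have h2 : HasDerivAt (fun x => ∫ ρ in σ..x, φ ρ (z x)) (φ σ (z σ)) σ := by
      -- split off the rough part with frozen `φ₂`: `(∫_σ^x β) • φ₂ σ (z σ)`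
      have h2a : HasDerivAt (fun x => (∫ ρ in σ..x, β ρ) • φ₂ σ (z σ)) (β σ • φ₂ σ (z σ)) σ :=
        hβσ.smul_const _
      -- the rest is `o(x − σ)` by joint continuity
      have h2b : HasDerivAt
          (fun x => (∫ ρ in σ..x, φ ρ (z x)) - (∫ ρ in σ..x, β ρ) • φ₂ σ (z σ))
          (φ₁ σ (z σ)) σ := by
        rw [hasDerivAt_iff_isLittleO]
        simp only [intervalIntegral.integral_same, sub_zero, zero_smul]
        rw [Asymptotics.isLittleO_iff]
        intro c' hc'
        -- continuity of `φ₁`, `φ₂` at `(σ, z σ)` and of `z` at `σ`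
        set η : ℝ := c' / (2 * (Cβ + 1)) with hη
        have hη0 : 0 < η := by positivity
        have hmem : (σ, z σ) ∈ Icc s t ×ˢ ball c R₀ := mk_mem_prod hσc (hzB σ hσc)
        have hc₁ := (Metric.continuousWithinAt_iff.1 (hφ₁ (σ, z σ) hmem)) (c' / 2) (by positivity)
        have hc₂ := (Metric.continuousWithinAt_iff.1 (hφ₂ (σ, z σ) hmem)) η hη0
        obtain ⟨δ₁, hδ₁, hφ₁δ⟩ := hc₁
        obtain ⟨δ₂, hδ₂, hφ₂δ⟩ := hc₂
        have hcz : ContinuousAt z σ :=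
          (hzcont.continuousWithinAt hσc).continuousAt (Icc_mem_nhds hσI.1 hσI.2)
        rw [Metric.continuousAt_iff] at hcz
        obtain ⟨δ₃, hδ₃, hzδ⟩ := hcz (min δ₁ δ₂) (lt_min hδ₁ hδ₂)
        have hI : ∀ᶠ x in 𝓝 σ, x ∈ Ioo s t := Ioo_mem_nhds hσI.1 hσI.2
        have hB : ∀ᶠ x in 𝓝 σ, dist x σ < min (min δ₁ δ₂) δ₃ :=
          Metric.ball_mem_nhds σ (lt_min (lt_min hδ₁ hδ₂) hδ₃)
        filter_upwards [hI, hB] with x hxI hxB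
        have hxI' : x ∈ Icc s t := Ioo_subset_Icc_self hxI
        have hx1 : dist x σ < δ₁ := (hxB.trans_le (min_le_left _ _)).trans_le (min_le_left _ _)
        have hx2 : dist x σ < δ₂ := (hxB.trans_le (min_le_left _ _)).trans_le (min_le_right _ _)
        have hx3 : dist x σ < δ₃ := hxB.trans_le (min_le_right _ _)
        have hzx : dist (z x) (z σ) < min δ₁ δ₂ := hzδ hx3
        -- pointwise bound for the integrand minus its frozen value
        have hbound : ∀ ρ ∈ Ι σ x,
            ‖(φ ρ (z x) - β ρ • φ₂ σ (z σ)) - φ₁ σ (z σ)‖ ≤ c' := by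
          intro ρ hρ
          obtain ⟨hρI, hρσ'⟩ := mem_Icc_and_abs_le_of_mem_uIoc_aux hσc hxI' hρ
          have hρσ : dist ρ σ ≤ dist x σ := by rw [Real.dist_eq, Real.dist_eq]; exact hρσ'
          have hd1 : dist (ρ, z x) (σ, z σ) < δ₁ := by
            rw [Prod.dist_eq]
            exact max_lt (hρσ.trans_lt hx1) (hzx.trans_le (min_le_left _ _))
          have hd2 : dist (ρ, z x) (σ, z σ) < δ₂ := by
            rw [Prod.dist_eq]
            exact max_lt (hρσ.trans_lt hx2) (hzx.trans_le (min_le_right _ _))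
          have hmemρ : (ρ, z x) ∈ Icc s t ×ˢ ball c R₀ := mk_mem_prod hρI (hzB x hxI')
          have e1 := hφ₁δ hmemρ hd1
          have e2 := hφ₂δ hmemρ hd2
          rw [dist_eq_norm] at e1 e2
          have e : (φ ρ (z x) - β ρ • φ₂ σ (z σ)) - φ₁ σ (z σ) =
              (φ₁ ρ (z x) - φ₁ σ (z σ)) + β ρ • (φ₂ ρ (z x) - φ₂ σ (z σ)) := by
            simp only [hφdef, smul_sub]; abel
          rw [e]
          calc ‖(φ₁ ρ (z x) - φ₁ σ (z σ)) + β ρ • (φ₂ ρ (z x) - φ₂ σ (z σ))‖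
              ≤ ‖φ₁ ρ (z x) - φ₁ σ (z σ)‖ + ‖β ρ‖ * ‖φ₂ ρ (z x) - φ₂ σ (z σ)‖ := by
                rw [← norm_smul]; exact norm_add_le _ _
            _ ≤ c' / 2 + Cβ * η := add_le_add e1.le (mul_le_mul (hβn ρ) e2.le (norm_nonneg _) hCβ0)
            _ ≤ c' := by
                rw [hη]
                have : Cβ * (c' / (2 * (Cβ + 1))) ≤ c' / 2 := by
                  rw [mul_div_assoc']
                  rw [div_le_div_iff₀ (by positivity) (by positivity)]
                  nlinarith
                linarith
        have hintφ : IntervalIntegrable (fun ρ => φ ρ (z x)) volume σ x :=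
          hφi (z x) (hzB x hxI') σ hσc x hxI'
        have hintβ : IntervalIntegrable (fun ρ => β ρ • φ₂ σ (z σ)) volume σ x :=
          (hβi σ x).smul_continuousOn continuousOn_const
        have e : (∫ ρ in σ..x, φ ρ (z x)) - (∫ ρ in σ..x, β ρ) • φ₂ σ (z σ) -
            (x - σ) • φ₁ σ (z σ) =
            ∫ ρ in σ..x, ((φ ρ (z x) - β ρ • φ₂ σ (z σ)) - φ₁ σ (z σ)) := by
          rw [intervalIntegral.integral_sub (hintφ.sub hintβ) intervalIntegrable_const,
            intervalIntegral.integral_sub hintφ hintβ, intervalIntegral.integral_const,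
            intervalIntegral.integral_smul_const]
        rw [e]
        calc ‖∫ ρ in σ..x, ((φ ρ (z x) - β ρ • φ₂ σ (z σ)) - φ₁ σ (z σ))‖ ≤ c' * |x - σ| :=
              intervalIntegral.norm_integral_le_of_norm_le_const hbound
          _ = c' * ‖x - σ‖ := by rw [Real.norm_eq_abs]
      have e : φ σ (z σ) = φ₁ σ (z σ) + β σ • φ₂ σ (z σ) := rfl
      rw [e]
      exact (h2b.add h2a).congr_of_eventuallyEq
        (Eventually.of_forall fun x => (sub_add_cancel _ _).symm)
    have h12 := (h1.add h2).congr_of_eventuallyEq hev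
    rwa [add_comm] at h12
  -- the integrand, truncated to `(s, t)`, is bounded and measurable
  set g : ℝ → F := fun σ => φ σ (z σ) + fderiv ℝ (Φ σ) (z σ) (z' σ) with hg
  set g₁ : ℝ → F := (Ioo s t).indicator g with hg₁
  have hg₁m : AEStronglyMeasurable g₁ volume := by
    rw [hg₁, aestronglyMeasurable_indicator_iff measurableSet_Ioo]
    have hmaps : MapsTo (fun σ => (σ, z σ)) (Icc s t) (Icc s t ×ˢ ball c R₀) := fun σ hσ =>
      mk_mem_prod hσ (hzB σ hσ)
    have hA : ContinuousOn (fun σ => fderiv ℝ (Φ σ) (z σ)) (Icc s t) :=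
      hDΦ.comp (continuousOn_id.prodMk hzcont) hmaps
    have hφ₁z : ContinuousOn (fun σ => φ₁ σ (z σ)) (Icc s t) :=
      hφ₁.comp (continuousOn_id.prodMk hzcont) hmaps
    have hφ₂z : ContinuousOn (fun σ => φ₂ σ (z σ)) (Icc s t) :=
      hφ₂.comp (continuousOn_id.prodMk hzcont) hmaps
    have h1 : AEStronglyMeasurable (fun σ => φ₁ σ (z σ)) (volume.restrict (Ioo s t)) :=
      (hφ₁z.mono Ioo_subset_Icc_self).aestronglyMeasurable measurableSet_Ioo
    have h1' : AEStronglyMeasurable (fun σ => β σ • φ₂ σ (z σ)) (volume.restrict (Ioo s t)) :=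
      hβm.aestronglyMeasurable.restrict.smul
        ((hφ₂z.mono Ioo_subset_Icc_self).aestronglyMeasurable measurableSet_Ioo)
    have h2 : AEStronglyMeasurable (fun σ => fderiv ℝ (Φ σ) (z σ)) (volume.restrict (Ioo s t)) :=
      (hA.mono Ioo_subset_Icc_self).aestronglyMeasurable measurableSet_Ioo
    have h3 : AEStronglyMeasurable (fun σ => fderiv ℝ (Φ σ) (z σ) (z' σ))
        (volume.restrict (Ioo s t)) := by
      have hpair := h2.prodMk hz'm.restrict
      exact (isBoundedBilinearMap_apply.continuous).comp_aestronglyMeasurable hpair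
    exact (h1.add h1').add h3
  have hg₁M : ∀ σ, ‖g₁ σ‖ ≤ Mφ + MD * N := by
    intro σ
    by_cases hσ : σ ∈ Ioo s t
    · rw [hg₁, indicator_of_mem hσ, hg]
      have hσc : σ ∈ Icc s t := Ioo_subset_Icc_self hσ
      refine (norm_add_le _ _).trans (add_le_add (hMφ' σ hσc (z σ) (hzin σ hσc)) ?_)
      calc ‖fderiv ℝ (Φ σ) (z σ) (z' σ)‖ ≤ ‖fderiv ℝ (Φ σ) (z σ)‖ * ‖z' σ‖ :=
            ContinuousLinearMap.le_opNorm _ _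
        _ ≤ MD * N := mul_le_mul (hMD' σ hσc (z σ) (hzin σ hσc)) (hz'N σ) (norm_nonneg _) hMD0
    · rw [hg₁, indicator_of_notMem hσ, norm_zero]; positivity
  have hderiv₁ : ∀ᵐ σ, σ ∈ Ioo s t → HasDerivAt Ψ (g₁ σ) σ := by
    filter_upwards [hderiv] with σ hσ hσI
    rw [hg₁, indicator_of_mem hσI]
    exact hσ hσI
  have key := sub_eq_integral_of_lipschitzOnWith_of_ae_hasDerivAt hst hΨlip hg₁m hg₁M hderiv₁
  -- `∫ g₁ = ∫ g` on `[s, t]`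
  have hgg : ∫ σ in s..t, g₁ σ = ∫ σ in s..t, g σ := by
    refine intervalIntegral.integral_congr_ae ?_
    have ht : ∀ᵐ σ : ℝ, σ ≠ t := by simp [ae_iff, measure_singleton]
    filter_upwards [ht] with σ hσt hσ
    rw [uIoc_of_le hst] at hσ
    rw [hg₁, indicator_of_mem (show σ ∈ Ioo s t from ⟨hσ.1, lt_of_le_of_ne hσ.2 hσt⟩)]
  rw [← hgg, ← key]

end PathFTC

end Literature.Analysis.FluidPDE

end
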